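import Summits.QuantumFields.BalabanUV.T4Continuum.Spine.NE1p.DressedSmallFieldOnCoresSlot
import Summits.QuantumFields.BalabanUV.T4Continuum.Support.SubstrateGaussianLettersBall
import Summits.QuantumFields.BalabanUV.T4Continuum.Support.SubstrateSlotsOfRecord

/-!
# T⁴ programme, spine estimate NE1′ (node O3b/H2) — THE SLOT END AT THE SUBSTRATE'S GAUSSIAN LETTERS OF RECORD: N0r §3's three
# operator-letter blocks `hm` ∕ `hN` ∕ `hq` DISCHARGED, per factor, into the substrate's PRIMITIVE scalar letter conditions BY NAME at the
# core letters of record `coreLettersOf A` (p3's `gaussN ∘ linForm` ∕ `gaussQ ∘ linForm`), and the same END read at `(slotsOfRecord …).act`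

Cell `pub-balaban`, sub-cell `t4`, BINDER-OWNERS row NE1′ (owner lineage t4-ne1p-p1); crew seat `b2b-balaban-t4-ne1p-formalise-leaf-01` (LEAF
PROVER 01, gen 12); crew row S⟨next⟩ (INTENT `CLAIMS.log` 2026-08-20T16:26:08Z).  ADDITIVE — imports the owner's N0r
`Spine/NE1p/DressedSmallFieldOnCoresSlot` (⇒ N0q ⇒ N0p ⇒ `Support/SubstrateActivities`), the SUBSTRATE cell's
`Support/SubstrateGaussianLettersBall` (p219975, seat p3; ⇒ `SubstrateGaussianLetters` p219426) and `Support/SubstrateSlotsOfRecord`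
(p220104, seat p1) ONLY; THEOREMS + one consistency `example` (0 `def`, 0 `def … : Prop`, 0 cite); nothing of N0p ∕ N0q ∕ N0r ∕ row
NE5's ∕ the substrate's modules is restated — used BY NAME (cross-cell exactly as row NE5's `Support/B13AssemblyCoresEndSubstrateLetters`,
p223680, the pattern).

WHY THIS FILE.  N0r §3 `attachedPart_locE_le_of_actOfLetters` ∕ `muPart_locE_le_of_actOfLetters` bound the attached part ∕ the
μ-part of the dressed small-field output of the substrate's SLOT ACTIVITIES `actOfLetters ℓ` for ANY letters `ℓ`, keeping DISPLAYED —
for every level `k`, window point `g ∈ W`, background `U`, carrier `X` and factor `p = (Z′, j)` — three operator-letter blocks on the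
open operator ball `ball (ctr k g U).1 (R′ k)` of the class centre: `hm` (`0 < mq`), `hN` (a.e.-strong measurability of `N o` in the
contour parameter, holomorphy of `o ↦ N o a`, the bound `‖N o a‖ ≤ N₀`), `hq` (joint measurability of `q o`, holomorphy of
`o ↦ q o a v`, the margin `mq‖v‖² − bq ≤ Re q o a v`) — N0r's docstring: «= row NE5's factor-letter blocks, dischargeable into p3's
`SubstrateGaussianLettersBall` lemmas as in `B13AssemblyCoresEndSubstrateLetters` — not done here».  At the substrate's CORE LETTERS
OF RECORD `coreLettersOf A` (`SubstrateSlotsOfRecord` §2: `N := gaussN (linForm base rd)`, `q := gaussQ (linForm base rd) coords`,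
`coreLettersOf_N` ∕ `coreLettersOf_q` are `rfl`) those blocks ARE p3's lemmas.  THIS FILE does that wiring, nothing else:
* §1 (kernel) `margin_pos`, `hN_coreLettersOf`, `hq_coreLettersOf` — the three blocks PRODUCED, in N0r's literal binder shape, from
  `measurable_gaussN ∘ measurable_linForm`, `differentiableOn_gaussN_linForm`, `norm_gaussN_linForm_le` (for `N`) and
  `aestronglyMeasurable_gaussQ`, `differentiableOn_gaussQ ∘ differentiableOn_linForm`, `margin_gaussQ_linForm` (for `q`) BY NAME, with
  the letters SPECIALISED to `N₀ k p X := gaussC (mI p.1 p.2)·√(max 1 (card!·β₀ Z′ j^{card} + d₀ Z′ j))`,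
  `mq k p X := (γ Z′ j − card (mI p.1 p.2)·ϑ Z′ j·R′ k)/2` (LEVEL-DEPENDENT — N0r types `mq : ℕ → Pol × J → C.Dom → ℝ`, so no uniform
  radius bound `R̄` is needed, sharper than row NE5's `mf`), `bq := 0`.  DISPLAYED INSTEAD (the substrate's S-U3 currency, finitely
  many SCALARS per factor `p`): measurability of the tables `(A Z j).base`, `(A Z j).rd` in the contour parameter (`hbase`, `hrdm`);
  `0 ≤ β₀ Z′ j`, `0 < d₀ Z′ j`, `0 ≤ R′ k`; the read-out bound `‖(A Z j).rd a ii jj‖ ≤ ϑ Z′ j` (`hrd`); the CENTRE CONDITIONS at every class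
  centre `(ctr k g U).1` and contour parameter `a` (`hctr`: (i) entries of the affine reading `≤ β₀ Z′ j`, (ii) its determinant REAL,
  (iii) real part `≥ d₀ Z′ j`, (iv) `γ Z′ j`-coercivity); the two ARITHMETIC smallnesses of the operator radius per level and factor
  `hbud : detBudget (card mI) (β₀ Z′ j) (ϑ Z′ j) (R′ k) < d₀ Z′ j` and `hmq : card (mI p.1 p.2)·ϑ Z′ j·R′ k < γ Z′ j` (margin alive ⇒ `hm` PROVED).
* §2 (kernel) **`attachedPart_locE_le_of_coreLettersOf`** ∕ **`muPart_locE_le_of_coreLettersOf`** — N0r §3's two ENDs ONCE BY NAME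
  each at `ℓ := coreLettersOf D P Op 𝒵 dom Jc V mI A` for ANY factor letters `A : ∀ Z j, ActLetters D P Op 𝒵 dom Jc V mI Z j` on a
  two-run object `D : DrivenRuns G` (carriers `D.carriers`; operator space `Op`, class data `ctr` ∕ `ROp` ∕ `RHist` ∕ `R′`, `locE`
  geometry `Ge` over `𝔇` all GENERAL), blocks from §1; every other binder VERBATIM (`hroom`, `hO` ∕ `hH`, `hscale`, `terms`, the
  clauses, (B3) `hM3` — now on the EXPLICIT letters `N₀`, `mq`, `bq = 0` —, N0m's `hϱ` ∕ `hϱA` resp. `μ₀ < μ₁`); conclusions LITERALLY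
  N0r's.  CENSUS vs N0r §3 (binders, by name): MINUS = [`mq`, `bq`, `N₀` (specialised), `hm` (proved), `hN`, `hq`]; PLUS = [`β₀`,
  `ϑ`, `d₀`, `γ` (letters per factor), `hbase`, `hrdm`, `hβ₀`, `hd₀`, `hR′`, `hrd`, `hctr`, `hbud`, `hmq`]; rest IDENTICAL.
* §3 (kernel) **`attachedPart_locE_le_slotsOfRecord_act`** ∕ **`muPart_locE_le_slotsOfRecord_act`** — §2 at `Op := OpDatum (SpeciesRec
  D o T ι′ Ω 𝒴)`, `A := L.A` for slot letters `L : SlotLetters …`, the activity written LITERALLY as the (2.14) ACTIVITY SLOT OF RECORD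
  `(slotsOfRecord D ι c a s P 𝒵 dom Jc V mI L).act p.1 p.2 op h` of MAP §O1 O-8 (`slotsOfRecord_act`, `rfl`).  The class centre `ctr`
  stays GENERAL: its identification with run B's operator datum of record `opOf (slotsOfRecord …).F (slotsOfRecord …).rawB g U k`
  (where row NE5 places its centre conditions) and with NE1′'s window classes is the substrate's ∕ the owner's READING — NOT asserted.

WHAT THIS DOES TO THE WALL (reading offered to the owner ∕ dagwriter; nothing re-labelled here).  For the substrate's activity slot of
record, the Gaussian OPERATOR-LETTER half of (B1a)'s input ((2.15)–(2.17) KIND: holomorphy and bound of the normalisation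
`N = (2π)^{−n/2}·det^{1/2}` and measurability ∕ holomorphy ∕ margin of the quadratic form on the operator ball) is KERNEL from finitely
many scalar per-factor conditions on the substrate's displayed tables `base` ∕ `rd` ∕ `coords` at the class centres — the SAME currency
row NE5's END of record uses (p223680).  Which tables realise Bałaban's `C^{(k)}(Z₀,σ)`, `Γ_k` of [Balaban1988RGII] (2.14) p. 15 and
WHETHER the datum of record meets the centre conditions is the SUBSTRATE's displayed identification, NOT claimed.  (B1b)'s residue
`terms` ∕ `emb` ∕ `hscale`, (B3) = `hM3`, (B4) ∕ (B5), `hO` ∕ `hH` stay DISPLAYED; 0 binders instantiated on Bałaban's densities; no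
numeral of print; no wall item discharged; wall line v1.6 does NOT move; R-t4r2-Q2 NOT met thereby; NE1′ NOT printed ∕ proved; 0∕9.

HONEST FRAMING.  By-name discharge of displayed binder SHAPES into the substrate's displayed scalar letter conditions over p3's PROVED
finite-dimensional lemmas ([folklore]); 0 estimates of print; printed loci are TYPE ∕ CONTEXT through the imported modules, re-asserted
nowhere; ABSOLUTE RULE honoured.  Rung (B)+1 on ONE finite four-torus — NOT infinite volume, NOT a mass gap, NOT OS on ℝ⁴, NOT Clay.
HONEST DEPENDENCY: continuum YM on T⁴ ⇐ BetaPertH ∧ nine spine estimates (0/9 proved); BetaPertH ⇐ (D1) ∧ (D4) ∧ CAP+tail; G-an2-4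
gates asym, D1 and NE2/3/4. -/

noncomputable section

namespace Summit.QuantumFields.BalabanUV.T4Continuum.NE1p.DressedSmallFieldOnCoresSlotLetters

open scoped BigOperators Matrix
open Metric Set MeasureTheory
open Literature.MathematicalPhysics.QuantumFieldTheory.Balaban1983to89
open Literature.MathematicalPhysics.QuantumFieldTheory.Balaban1983to89.B13Resummation (locE Geometry)
open Literature.MathematicalPhysics.QuantumFieldTheory.Balaban1983to89.B5Prop11Lower (nsq)
open Summit.QuantumFields.BalabanUV.T4Continuum.B13OpDatum (OpDatum)
open Summit.QuantumFields.BalabanUV.T4Continuum.B13HistMeasurable (MeasPotFrame B13HistM)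
open Summit.QuantumFields.BalabanUV.T4Continuum.SubstrateTwoRunsDriven (DrivenRuns)
open Summit.QuantumFields.BalabanUV.T4Continuum.SubstrateActivities (coreOf actOfLetters)
open Summit.QuantumFields.BalabanUV.T4Continuum.SubstrateGaussianLetters (gaussC linForm measurable_gaussN measurable_linForm
  aestronglyMeasurable_gaussQ differentiableOn_gaussQ differentiableOn_linForm margin_gaussQ_linForm)
open Summit.QuantumFields.BalabanUV.T4Continuum.SubstrateGaussianLettersBall (detBudget differentiableOn_gaussN_linForm
  norm_gaussN_linForm_le)
open Summit.QuantumFields.BalabanUV.T4Continuum.SubstrateSlotsOfRecord (ActLetters coreLettersOf SpeciesRec SlotLetters slotsOfRecord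
  slotsOfRecord_act)
open Summit.QuantumFields.BalabanUV.T4Continuum.NE1p.DressedSmallFieldOnCoresSlot (attachedPart_locE_le_of_actOfLetters
  muPart_locE_le_of_actOfLetters)

variable {G : Type} [GaugeGroup G] (D : DrivenRuns G) (P : MeasPotFrame D.carriers)

/-! ## §1 At the core letters of record `coreLettersOf A`: N0r's three operator-letter blocks PRODUCED from p3's letter conditions -/

section CoreLettersOf

variable (Op : Type) [NormedAddCommGroup Op] [NormedSpace ℂ Op] {J : Type}
  (𝒵 : D.carriers.Dom → J → Type) [∀ Z j, Fintype (𝒵 Z j)] (dom : ∀ Z j, 𝒵 Z j → D.carriers.Dom)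
  (Jc : D.carriers.Dom → J → Type) [∀ Z j, Fintype (Jc Z j)]
  (V : D.carriers.Dom → J → Type) [∀ Z j, NormedAddCommGroup (V Z j)] [∀ Z j, InnerProductSpace ℝ (V Z j)]
  [∀ Z j, MeasurableSpace (V Z j)] [∀ Z j, BorelSpace (V Z j)] [∀ Z j, FiniteDimensional ℝ (V Z j)]
  (mI : D.carriers.Dom → J → Type) [∀ Z j, Fintype (mI Z j)] [∀ Z j, DecidableEq (mI Z j)]

omit [∀ Z j, DecidableEq (mI Z j)] in
/-- **N0r's `hm` block PROVED**: the margin letter `mq k p X := (γ Z′ j − card (mI p.1 p.2)·ϑ Z′ j·R′ k)/2` is positive as soon as the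
operator radius is small against the coercivity letter, `card·ϑ·R′ k < γ` (ARITHMETIC, per level and factor). [folklore] -/
theorem margin_pos {W : Set (ℕ → ℝ)} {R' : ℕ → ℝ} {ϑ γ : D.carriers.Dom → J → ℝ}
    (hmq : ∀ k Z j, Fintype.card (mI Z j) * ϑ Z j * R' k < γ Z j) :
    ∀ k, ∀ g ∈ W, ∀ (U : D.carriers.BgB) (X : D.carriers.Dom), D.carriers.scale X = k → ∀ p : D.carriers.Dom × J,
      0 < (γ p.1 p.2 - Fintype.card (mI p.1 p.2) * ϑ p.1 p.2 * R' k) / 2 :=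
  fun k _ _ _ _ _ p => half_pos (sub_pos.mpr (hmq k p.1 p.2))

omit [∀ Z j, BorelSpace (V Z j)] [∀ Z j, FiniteDimensional ℝ (V Z j)] in
/-- **N0r's `hN` block PRODUCED at the core letters of record** (kernel; p3's `measurable_gaussN ∘ measurable_linForm`,
`differentiableOn_gaussN_linForm`, `norm_gaussN_linForm_le` BY NAME; `(coreLettersOf A Z j).N = gaussN (linForm base rd)` is `rfl`): on every
class ball the normalisation letter is a.e.-strongly measurable in the contour parameter, holomorphic in the operator datum and bounded by
`gaussC (mI p.1 p.2)·√(max 1 (card!·β₀ Z′ j^{card} + d₀ Z′ j))` — from `hbase` ∕ `hrdm`, `0 ≤ β₀`, `0 < d₀`, `0 ≤ R′`, `hrd`, the CENTRE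
CONDITIONS (entries `≤ β₀`, determinant real with real part `≥ d₀`; coercivity unused here) and `detBudget (card mI) β₀ ϑ (R′ k) < d₀`.
[folklore] -/
theorem hN_coreLettersOf {W : Set (ℕ → ℝ)} {ctr : ℕ → (ℕ → ℝ) → D.carriers.BgB → Op × B13HistM P} {R' : ℕ → ℝ}
    (A : ∀ Z j, ActLetters D P Op 𝒵 dom Jc V mI Z j) {β₀ ϑ d₀ γ : D.carriers.Dom → J → ℝ} (hR' : ∀ k, 0 ≤ R' k)
    (hbase : ∀ Z j ii jj, Measurable fun a => (A Z j).base a ii jj)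
    (hrdm : ∀ Z j ii jj (o' : Op), Measurable fun a => (A Z j).rd a ii jj o')
    (hβ₀ : ∀ Z j, 0 ≤ β₀ Z j) (hd₀ : ∀ Z j, 0 < d₀ Z j)
    (hrd : ∀ Z j a ii jj, ‖(A Z j).rd a ii jj‖ ≤ ϑ Z j)
    (hctr : ∀ k, ∀ g ∈ W, ∀ (U : D.carriers.BgB) (Z : D.carriers.Dom) (j : J) (a : (Jc Z j ⊕ 𝒵 Z j) → ℝ × ℝ),
      (∀ ii jj, ‖linForm (A Z j).base (A Z j).rd (ctr k g U).1 a ii jj‖ ≤ β₀ Z j) ∧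
      ((linForm (A Z j).base (A Z j).rd (ctr k g U).1 a).det).im = 0 ∧ d₀ Z j ≤ ((linForm (A Z j).base (A Z j).rd (ctr k g U).1 a).det).re ∧
      (∀ x : mI Z j → ℂ, γ Z j * nsq x ≤ (star x ⬝ᵥ (linForm (A Z j).base (A Z j).rd (ctr k g U).1 a *ᵥ x)).re))
    (hbud : ∀ k Z j, detBudget (Fintype.card (mI Z j)) (β₀ Z j) (ϑ Z j) (R' k) < d₀ Z j) :
    ∀ k, ∀ g ∈ W, ∀ (U : D.carriers.BgB) (X : D.carriers.Dom), D.carriers.scale X = k → ∀ p : D.carriers.Dom × J,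
      (∀ o' ∈ ball (ctr k g U).1 (R' k), AEStronglyMeasurable ((coreLettersOf D P Op 𝒵 dom Jc V mI A p.1 p.2).N o')
          (coreOf P Op 𝒵 dom Jc V (coreLettersOf D P Op 𝒵 dom Jc V mI A) p.1 p.2).lam) ∧
      (∀ a, DifferentiableOn ℂ (fun o' => (coreLettersOf D P Op 𝒵 dom Jc V mI A p.1 p.2).N o' a) (ball (ctr k g U).1 (R' k))) ∧
      (∀ o' ∈ ball (ctr k g U).1 (R' k), ∀ a, ‖(coreLettersOf D P Op 𝒵 dom Jc V mI A p.1 p.2).N o' a‖ ≤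
          gaussC (mI p.1 p.2) *
            Real.sqrt (max 1 ((Fintype.card (mI p.1 p.2)).factorial * β₀ p.1 p.2 ^ Fintype.card (mI p.1 p.2) + d₀ p.1 p.2))) := by
  intro k g hg U X _ p
  refine ⟨fun o' _ => (measurable_gaussN _ (measurable_linForm (A p.1 p.2).base (A p.1 p.2).rd (hbase p.1 p.2) (hrdm p.1 p.2)
      o')).aestronglyMeasurable, fun a => ?_, fun o' ho' a => ?_⟩
  · obtain ⟨hc, hreal, hpos, -⟩ := hctr k g hg U p.1 p.2 a
    exact differentiableOn_gaussN_linForm _ _ (hβ₀ p.1 p.2) (hR' k) hc (hrd p.1 p.2 a) hreal (hd₀ p.1 p.2) hpos (hbud k p.1 p.2)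
  · obtain ⟨hc, -, -, -⟩ := hctr k g hg U p.1 p.2 a
    exact norm_gaussN_linForm_le _ _ (hβ₀ p.1 p.2) (hR' k) hc (hrd p.1 p.2 a) (hbud k p.1 p.2) ho'

/-- **N0r's `hq` block PRODUCED at the core letters of record** (kernel; p3's `aestronglyMeasurable_gaussQ`,
`differentiableOn_gaussQ ∘ differentiableOn_linForm`, `margin_gaussQ_linForm` BY NAME; `(coreLettersOf A Z j).q = gaussQ (linForm base rd) coords`
is `rfl`): on every class ball the quadratic-form letter is jointly measurable, holomorphic in the operator datum, with the margin
`((γ Z′ j − card·ϑ Z′ j·R′ k)/2)·‖v‖² − 0 ≤ Re q` — from `hbase` ∕ `hrdm`, `hrd` and the centre's `γ`-coercivity (other clauses unused). [folklore] -/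
theorem hq_coreLettersOf {W : Set (ℕ → ℝ)} {ctr : ℕ → (ℕ → ℝ) → D.carriers.BgB → Op × B13HistM P} {R' : ℕ → ℝ}
    (A : ∀ Z j, ActLetters D P Op 𝒵 dom Jc V mI Z j) {β₀ ϑ d₀ γ : D.carriers.Dom → J → ℝ}
    (hbase : ∀ Z j ii jj, Measurable fun a => (A Z j).base a ii jj)
    (hrdm : ∀ Z j ii jj (o' : Op), Measurable fun a => (A Z j).rd a ii jj o')
    (hrd : ∀ Z j a ii jj, ‖(A Z j).rd a ii jj‖ ≤ ϑ Z j)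
    (hctr : ∀ k, ∀ g ∈ W, ∀ (U : D.carriers.BgB) (Z : D.carriers.Dom) (j : J) (a : (Jc Z j ⊕ 𝒵 Z j) → ℝ × ℝ),
      (∀ ii jj, ‖linForm (A Z j).base (A Z j).rd (ctr k g U).1 a ii jj‖ ≤ β₀ Z j) ∧
      ((linForm (A Z j).base (A Z j).rd (ctr k g U).1 a).det).im = 0 ∧ d₀ Z j ≤ ((linForm (A Z j).base (A Z j).rd (ctr k g U).1 a).det).re ∧
      (∀ x : mI Z j → ℂ, γ Z j * nsq x ≤ (star x ⬝ᵥ (linForm (A Z j).base (A Z j).rd (ctr k g U).1 a *ᵥ x)).re)) :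
    ∀ k, ∀ g ∈ W, ∀ (U : D.carriers.BgB) (X : D.carriers.Dom), D.carriers.scale X = k → ∀ p : D.carriers.Dom × J,
      (∀ o' ∈ ball (ctr k g U).1 (R' k),
        AEStronglyMeasurable (Function.uncurry ((coreLettersOf D P Op 𝒵 dom Jc V mI A p.1 p.2).q o'))
          ((coreOf P Op 𝒵 dom Jc V (coreLettersOf D P Op 𝒵 dom Jc V mI A) p.1 p.2).lam.prod volume)) ∧
      (∀ a v, DifferentiableOn ℂ (fun o' => (coreLettersOf D P Op 𝒵 dom Jc V mI A p.1 p.2).q o' a v)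
          (ball (ctr k g U).1 (R' k))) ∧
      (∀ o' ∈ ball (ctr k g U).1 (R' k), ∀ a v,
        (γ p.1 p.2 - Fintype.card (mI p.1 p.2) * ϑ p.1 p.2 * R' k) / 2 * ‖v‖ ^ 2 - 0 ≤
          ((coreLettersOf D P Op 𝒵 dom Jc V mI A p.1 p.2).q o' a v).re) := by
  intro k g hg U X _ p
  refine ⟨fun o' _ => aestronglyMeasurable_gaussQ _ (A p.1 p.2).coords
      (measurable_linForm (A p.1 p.2).base (A p.1 p.2).rd (hbase p.1 p.2) (hrdm p.1 p.2) o') _ _,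
    fun a v => differentiableOn_gaussQ _ (A p.1 p.2).coords
      (fun ii jj => differentiableOn_linForm (A p.1 p.2).base (A p.1 p.2).rd _ a ii jj) v,
    fun o' ho' a v => ?_⟩
  obtain ⟨-, -, -, hco⟩ := hctr k g hg U p.1 p.2 a
  exact margin_gaussQ_linForm _ _ _ hco (hrd p.1 p.2 a) ho' v

/-! ## §2 N0r's two slot ENDs at `coreLettersOf A`, operator letters DISCHARGED -/

variable (𝔇 : LocDomainSys) {Cube : Type} [DecidableEq Cube] (Ge : Geometry 𝔇 Cube)

open Classical in
/-- **THE ATTACHED PART OF THE DRESSED SMALL-FIELD OUTPUT OF THE SLOT ACTIVITIES AT THE CORE LETTERS OF RECORD, OPERATOR LETTERS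
DISCHARGED** (kernel; N0r §3 `attachedPart_locE_le_of_actOfLetters` ONCE BY NAME at `ℓ := coreLettersOf D P Op 𝒵 dom Jc V mI A`, letters
`N₀ k p X := gaussC (mI p.1 p.2)·√(max 1 (card!·β₀ Z′ j^{card} + d₀ Z′ j))`, `mq k p X := (γ Z′ j − card·ϑ Z′ j·R′ k)/2`, `bq := 0`, blocks `hm` ∕
`hN` ∕ `hq` from §1).  Binders, all DISPLAYED: `hroom`, `0 ≤ R′ k`; per factor the substrate's primitive letter conditions `hbase` ∕
`hrdm` ∕ `hβ₀` ∕ `hd₀` ∕ `hrd`, the CENTRE CONDITIONS `hctr` at every class centre, the radius smallnesses `hbud` ∕ `hmq`; then N0r's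
VERBATIM (`hO` ∕ `hH`, `hscale`, `terms`, the clauses, (B3) `hM3` on the explicit letters, `hϱ` ∕ `hϱA`).  Conclusion LITERALLY N0r's.
Nothing of the substrate's data is asserted. [folklore] -/
theorem attachedPart_locE_le_of_coreLettersOf {W : Set (ℕ → ℝ)} {ctr : ℕ → (ℕ → ℝ) → D.carriers.BgB → Op × B13HistM P}
    {ROp RHist R' : ℕ → ℝ} (A : ∀ Z j, ActLetters D P Op 𝒵 dom Jc V mI Z j) {β₀ ϑ d₀ γ : D.carriers.Dom → J → ℝ}
    (hroom : ∀ k, ROp k < R' k) (hR' : ∀ k, 0 ≤ R' k)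
    -- the substrate's PRIMITIVE per-factor letter conditions (S-U3 currency) replacing N0r's `hm` ∕ `hN` ∕ `hq`
    (hbase : ∀ Z j ii jj, Measurable fun a => (A Z j).base a ii jj)
    (hrdm : ∀ Z j ii jj (o' : Op), Measurable fun a => (A Z j).rd a ii jj o')
    (hβ₀ : ∀ Z j, 0 ≤ β₀ Z j) (hd₀ : ∀ Z j, 0 < d₀ Z j)
    (hrd : ∀ Z j a ii jj, ‖(A Z j).rd a ii jj‖ ≤ ϑ Z j)
    -- the CENTRE CONDITIONS at every class centre: entry bound, real determinant with real part `≥ d₀`, `γ`-coercivity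
    (hctr : ∀ k, ∀ g ∈ W, ∀ (U : D.carriers.BgB) (Z : D.carriers.Dom) (j : J) (a : (Jc Z j ⊕ 𝒵 Z j) → ℝ × ℝ),
      (∀ ii jj, ‖linForm (A Z j).base (A Z j).rd (ctr k g U).1 a ii jj‖ ≤ β₀ Z j) ∧
      ((linForm (A Z j).base (A Z j).rd (ctr k g U).1 a).det).im = 0 ∧ d₀ Z j ≤ ((linForm (A Z j).base (A Z j).rd (ctr k g U).1 a).det).re ∧
      (∀ x : mI Z j → ℂ, γ Z j * nsq x ≤ (star x ⬝ᵥ (linForm (A Z j).base (A Z j).rd (ctr k g U).1 a *ᵥ x)).re))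
    -- the two ARITHMETIC smallnesses of the operator radius, per level and factor
    (hbud : ∀ k Z j, detBudget (Fintype.card (mI Z j)) (β₀ Z j) (ϑ Z j) (R' k) < d₀ Z j)
    (hmq : ∀ k Z j, Fintype.card (mI Z j) * ϑ Z j * R' k < γ Z j)
    {k : ℕ} {g : ℕ → ℝ} (hg : g ∈ W) {U : D.carriers.BgB} {o : Op} {h₀ w : B13HistM P} {ϱ : ℝ}
    (hO : ‖o - (ctr k g U).1‖ ≤ ROp k) (hH : ‖h₀ - (ctr k g U).2‖ + ϱ * ‖w‖ ≤ RHist k)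
    {emb : 𝔇.Dom → D.carriers.Dom} (hscale : ∀ Z, D.carriers.scale (emb Z) = k)
    (terms : 𝔇.Dom → Finset (D.carriers.Dom × J))
    {A₀ A₁ R r₁ b₅ : ℝ} {X₀ : 𝔇.Dom} (hA₀ : 0 ≤ A₀) (hA₁ : 0 ≤ A₁) (hr₁ : 0 ≤ r₁) (hb : r₁ * 5 ≤ b₅)
    (hrate : r₁ + 2 * Ge.κ₀ + 2 ≤ R) (hsmall : (A₀ + ϱ * A₁) * Real.exp (b₅ + 1) * Ge.K₀ * Ge.ν * Ge.c₁ ≤ 1)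
    (hM3 : ∀ Z, Ge.cubes Z ⊆ Ge.cubes X₀ →
      ∑ p ∈ terms Z, (coreOf P Op 𝒵 dom Jc V (coreLettersOf D P Op 𝒵 dom Jc V mI A) p.1 p.2).lam.real univ *
          ((coreOf P Op 𝒵 dom Jc V (coreLettersOf D P Op 𝒵 dom Jc V mI A) p.1 p.2).wB *
              (gaussC (mI p.1 p.2) * Real.sqrt (max 1 ((Fintype.card (mI p.1 p.2)).factorial *
                β₀ p.1 p.2 ^ Fintype.card (mI p.1 p.2) + d₀ p.1 p.2))) * Real.exp 0) *
          (Real.pi / ((γ p.1 p.2 - Fintype.card (mI p.1 p.2) * ϑ p.1 p.2 * R' k) / 2 / 2)) ^ (Module.finrank ℝ (V p.1 p.2) / 2 : ℝ) *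
        Real.exp ((coreOf P Op 𝒵 dom Jc V (coreLettersOf D P Op 𝒵 dom Jc V mI A) p.1 p.2).N₁ * (‖h₀‖ + ϱ * ‖w‖)) ≤
        (A₀ + ϱ * A₁) * Real.exp (-(R * 𝔇.dj Z)))
    (hϱ : 2 ≤ ϱ) (hϱA : A₀ ≤ ϱ * A₁) :
    ‖locE Ge.ι Ge.cubes (fun Z => ∑ p ∈ terms Z,
          actOfLetters P Op 𝒵 dom Jc V (coreLettersOf D P Op 𝒵 dom Jc V mI A) p.1 p.2 o (h₀ + w)) (Ge.cubes X₀) -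
        locE Ge.ι Ge.cubes (fun Z => ∑ p ∈ terms Z,
          actOfLetters P Op 𝒵 dom Jc V (coreLettersOf D P Op 𝒵 dom Jc V mI A) p.1 p.2 o h₀) (Ge.cubes X₀)‖ ≤
      4 * (Real.exp 1 * Ge.ν * Ge.c₁ * Ge.K₀ ^ 2) * A₁ * Real.exp (-(r₁ * 𝔇.dj X₀)) :=
  attachedPart_locE_le_of_actOfLetters P Op 𝒵 dom Jc V 𝔇 Ge (coreLettersOf D P Op 𝒵 dom Jc V mI A)
    (mq := fun k p _ => (γ p.1 p.2 - Fintype.card (mI p.1 p.2) * ϑ p.1 p.2 * R' k) / 2) (bq := fun _ _ _ => 0)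
    (N₀ := fun _ p _ => gaussC (mI p.1 p.2) *
      Real.sqrt (max 1 ((Fintype.card (mI p.1 p.2)).factorial * β₀ p.1 p.2 ^ Fintype.card (mI p.1 p.2) + d₀ p.1 p.2)))
    hroom (margin_pos D mI hmq) (hN_coreLettersOf D P Op 𝒵 dom Jc V mI A hR' hbase hrdm hβ₀ hd₀ hrd hctr hbud)
    (hq_coreLettersOf D P Op 𝒵 dom Jc V mI A hbase hrdm hrd hctr) hg hO hH hscale terms hA₀ hA₁ hr₁ hb hrate hsmall hM3 hϱ hϱA

open Classical in
/-- **THE μ-PART OF THE SAME, OPERATOR LETTERS DISCHARGED** (kernel; N0r §3 `muPart_locE_le_of_actOfLetters` ONCE BY NAME at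
`ℓ := coreLettersOf … A`, letters and blocks as above): SOURCE pencil `h₀ + s • v` (`‖s‖ < μ₁`; MAP §O1 D-5′), `0 < μ₀ < μ₁`, `‖sμ‖ ≤ μ₀`,
(B3) `hM3` at the constant `A'`, class radius `hH` at `μ₁`; conclusion LITERALLY N0r's `≤ (e ν c₁ K₀²·A'·e^{−r₁ dj X₀})·μ₀/(μ₁ − μ₀)`.
[folklore] -/
theorem muPart_locE_le_of_coreLettersOf {W : Set (ℕ → ℝ)} {ctr : ℕ → (ℕ → ℝ) → D.carriers.BgB → Op × B13HistM P}
    {ROp RHist R' : ℕ → ℝ} (A : ∀ Z j, ActLetters D P Op 𝒵 dom Jc V mI Z j) {β₀ ϑ d₀ γ : D.carriers.Dom → J → ℝ}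
    (hroom : ∀ k, ROp k < R' k) (hR' : ∀ k, 0 ≤ R' k)
    (hbase : ∀ Z j ii jj, Measurable fun a => (A Z j).base a ii jj)
    (hrdm : ∀ Z j ii jj (o' : Op), Measurable fun a => (A Z j).rd a ii jj o')
    (hβ₀ : ∀ Z j, 0 ≤ β₀ Z j) (hd₀ : ∀ Z j, 0 < d₀ Z j)
    (hrd : ∀ Z j a ii jj, ‖(A Z j).rd a ii jj‖ ≤ ϑ Z j)
    (hctr : ∀ k, ∀ g ∈ W, ∀ (U : D.carriers.BgB) (Z : D.carriers.Dom) (j : J) (a : (Jc Z j ⊕ 𝒵 Z j) → ℝ × ℝ),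
      (∀ ii jj, ‖linForm (A Z j).base (A Z j).rd (ctr k g U).1 a ii jj‖ ≤ β₀ Z j) ∧
      ((linForm (A Z j).base (A Z j).rd (ctr k g U).1 a).det).im = 0 ∧ d₀ Z j ≤ ((linForm (A Z j).base (A Z j).rd (ctr k g U).1 a).det).re ∧
      (∀ x : mI Z j → ℂ, γ Z j * nsq x ≤ (star x ⬝ᵥ (linForm (A Z j).base (A Z j).rd (ctr k g U).1 a *ᵥ x)).re))
    (hbud : ∀ k Z j, detBudget (Fintype.card (mI Z j)) (β₀ Z j) (ϑ Z j) (R' k) < d₀ Z j)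
    (hmq : ∀ k Z j, Fintype.card (mI Z j) * ϑ Z j * R' k < γ Z j)
    {k : ℕ} {g : ℕ → ℝ} (hg : g ∈ W) {U : D.carriers.BgB} {o : Op} {h₀ v : B13HistM P} {μ₁ : ℝ}
    (hO : ‖o - (ctr k g U).1‖ ≤ ROp k) (hH : ‖h₀ - (ctr k g U).2‖ + μ₁ * ‖v‖ ≤ RHist k)
    {emb : 𝔇.Dom → D.carriers.Dom} (hscale : ∀ Z, D.carriers.scale (emb Z) = k)
    (terms : 𝔇.Dom → Finset (D.carriers.Dom × J))
    {A' R r₁ b₅ μ₀ : ℝ} {X₀ : 𝔇.Dom} {sμ : ℂ} (hA : 0 ≤ A') (hr₁ : 0 ≤ r₁) (hb : r₁ * 5 ≤ b₅)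
    (hrate : r₁ + 2 * Ge.κ₀ + 2 ≤ R) (hsmall : A' * Real.exp (b₅ + 1) * Ge.K₀ * Ge.ν * Ge.c₁ ≤ 1)
    (hM3 : ∀ Z, Ge.cubes Z ⊆ Ge.cubes X₀ →
      ∑ p ∈ terms Z, (coreOf P Op 𝒵 dom Jc V (coreLettersOf D P Op 𝒵 dom Jc V mI A) p.1 p.2).lam.real univ *
          ((coreOf P Op 𝒵 dom Jc V (coreLettersOf D P Op 𝒵 dom Jc V mI A) p.1 p.2).wB *
              (gaussC (mI p.1 p.2) * Real.sqrt (max 1 ((Fintype.card (mI p.1 p.2)).factorial *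
                β₀ p.1 p.2 ^ Fintype.card (mI p.1 p.2) + d₀ p.1 p.2))) * Real.exp 0) *
          (Real.pi / ((γ p.1 p.2 - Fintype.card (mI p.1 p.2) * ϑ p.1 p.2 * R' k) / 2 / 2)) ^ (Module.finrank ℝ (V p.1 p.2) / 2 : ℝ) *
        Real.exp ((coreOf P Op 𝒵 dom Jc V (coreLettersOf D P Op 𝒵 dom Jc V mI A) p.1 p.2).N₁ * (‖h₀‖ + μ₁ * ‖v‖)) ≤
        A' * Real.exp (-(R * 𝔇.dj Z)))
    (h0 : 0 < μ₀) (h01 : μ₀ < μ₁) (hμ : ‖sμ‖ ≤ μ₀) :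
    ‖locE Ge.ι Ge.cubes (fun Z => ∑ p ∈ terms Z,
          actOfLetters P Op 𝒵 dom Jc V (coreLettersOf D P Op 𝒵 dom Jc V mI A) p.1 p.2 o (h₀ + sμ • v)) (Ge.cubes X₀) -
        locE Ge.ι Ge.cubes (fun Z => ∑ p ∈ terms Z,
          actOfLetters P Op 𝒵 dom Jc V (coreLettersOf D P Op 𝒵 dom Jc V mI A) p.1 p.2 o h₀) (Ge.cubes X₀)‖ ≤
      Real.exp 1 * Ge.ν * Ge.c₁ * Ge.K₀ ^ 2 * A' * Real.exp (-(r₁ * 𝔇.dj X₀)) * (μ₀ / (μ₁ - μ₀)) :=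
  muPart_locE_le_of_actOfLetters P Op 𝒵 dom Jc V 𝔇 Ge (coreLettersOf D P Op 𝒵 dom Jc V mI A)
    (mq := fun k p _ => (γ p.1 p.2 - Fintype.card (mI p.1 p.2) * ϑ p.1 p.2 * R' k) / 2) (bq := fun _ _ _ => 0)
    (N₀ := fun _ p _ => gaussC (mI p.1 p.2) *
      Real.sqrt (max 1 ((Fintype.card (mI p.1 p.2)).factorial * β₀ p.1 p.2 ^ Fintype.card (mI p.1 p.2) + d₀ p.1 p.2)))
    hroom (margin_pos D mI hmq) (hN_coreLettersOf D P Op 𝒵 dom Jc V mI A hR' hbase hrdm hβ₀ hd₀ hrd hctr hbud)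
    (hq_coreLettersOf D P Op 𝒵 dom Jc V mI A hbase hrdm hrd hctr) hg hO hH hscale terms hA hr₁ hb hrate hsmall hM3 h0 h01 hμ

open Classical in
/-- (consistency, in kernel) With NO factor attached (`terms Z := ∅`) the two slot functionals of §2 coincide and the bounded quantity IS
`0`: the ENDs' left-hand side hides nothing; a LIVE inhabitant of §1's letter conditions is a witness row, not this file. [folklore] -/
example (A : ∀ Z j, ActLetters D P Op 𝒵 dom Jc V mI Z j) (o : Op) (h₀ w : B13HistM P) (X₀ : 𝔇.Dom) :
    ‖locE Ge.ι Ge.cubes (fun _ => ∑ p ∈ (∅ : Finset (D.carriers.Dom × J)),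
          actOfLetters P Op 𝒵 dom Jc V (coreLettersOf D P Op 𝒵 dom Jc V mI A) p.1 p.2 o (h₀ + w)) (Ge.cubes X₀) -
        locE Ge.ι Ge.cubes (fun _ => ∑ p ∈ (∅ : Finset (D.carriers.Dom × J)),
          actOfLetters P Op 𝒵 dom Jc V (coreLettersOf D P Op 𝒵 dom Jc V mI A) p.1 p.2 o h₀) (Ge.cubes X₀)‖ = 0 := by
  simp only [Finset.sum_empty, sub_self, norm_zero]

end CoreLettersOf

/-! ## §3 The same two ENDs read AT THE ACTIVITY SLOT OF RECORD `(slotsOfRecord …).act` (MAP §O1 O-8; `slotsOfRecord_act` is `rfl`) -/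

section SlotsOfRecord

open Summit.QuantumFields.BalabanUV.T4Continuum.B13StepTermLabels (InnerLabel)
open Summit.QuantumFields.BalabanUV.T4Continuum.B13InnerData (Bnd)

variable {o : Type} [Fintype o] [DecidableEq o] (ι : G →* Matrix o o ℂ) (c : ℂ) (a : ℝ) (s : ℕ → ℂ)
variable {T ι' S Ω 𝒴 : Type} {IOp : Type*}
  (𝒵 : D.carriers.Dom → InnerLabel D.carriers.Dom (Bnd D.toTwoRuns) → Type) [∀ Z j, Fintype (𝒵 Z j)]
  (dom : ∀ Z j, 𝒵 Z j → D.carriers.Dom)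
  (Jc : D.carriers.Dom → InnerLabel D.carriers.Dom (Bnd D.toTwoRuns) → Type) [∀ Z j, Fintype (Jc Z j)]
  (V : D.carriers.Dom → InnerLabel D.carriers.Dom (Bnd D.toTwoRuns) → Type) [∀ Z j, NormedAddCommGroup (V Z j)]
  [∀ Z j, InnerProductSpace ℝ (V Z j)] [∀ Z j, MeasurableSpace (V Z j)] [∀ Z j, BorelSpace (V Z j)] [∀ Z j, FiniteDimensional ℝ (V Z j)]
  (mI : D.carriers.Dom → InnerLabel D.carriers.Dom (Bnd D.toTwoRuns) → Type) [∀ Z j, Fintype (mI Z j)] [∀ Z j, DecidableEq (mI Z j)]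
  (L : SlotLetters D (o := o) (T := T) (ι' := ι') (S := S) (Ω := Ω) (𝒴 := 𝒴) P (IOp := IOp) 𝒵 dom Jc V mI)
variable (𝔇 : LocDomainSys) {Cube : Type} [DecidableEq Cube] (Ge : Geometry 𝔇 Cube)

open Classical in
/-- **THE ATTACHED PART OF THE DRESSED SMALL-FIELD OUTPUT OF THE ACTIVITY SLOT OF RECORD** (kernel; §2's
`attachedPart_locE_le_of_coreLettersOf` at `Op := OpDatum (SpeciesRec D o T ι′ Ω 𝒴)`, `A := L.A`, the activities written LITERALLY as
`(slotsOfRecord D ι c a s P 𝒵 dom Jc V mI L).act p.1 p.2 op h` — `slotsOfRecord_act`, `rfl`).  The class centre `ctr` is GENERAL: its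
identification with run B's operator datum of record `opOf (slotsOfRecord …).F (slotsOfRecord …).rawB g U k` (where row NE5's END of record
places the centre conditions) and with NE1′'s window classes is the substrate's ∕ the owner's READING, NOT asserted here. [folklore] -/
theorem attachedPart_locE_le_slotsOfRecord_act {W : Set (ℕ → ℝ)}
    {ctr : ℕ → (ℕ → ℝ) → D.carriers.BgB → OpDatum (SpeciesRec D o T ι' Ω 𝒴) × B13HistM P} {ROp RHist R' : ℕ → ℝ}
    {β₀ ϑ d₀ γ : D.carriers.Dom → InnerLabel D.carriers.Dom (Bnd D.toTwoRuns) → ℝ}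
    (hroom : ∀ k, ROp k < R' k) (hR' : ∀ k, 0 ≤ R' k)
    (hbase : ∀ Z j ii jj, Measurable fun a' => (L.A Z j).base a' ii jj)
    (hrdm : ∀ Z j ii jj (o' : OpDatum (SpeciesRec D o T ι' Ω 𝒴)), Measurable fun a' => (L.A Z j).rd a' ii jj o')
    (hβ₀ : ∀ Z j, 0 ≤ β₀ Z j) (hd₀ : ∀ Z j, 0 < d₀ Z j)
    (hrd : ∀ Z j a' ii jj, ‖(L.A Z j).rd a' ii jj‖ ≤ ϑ Z j)
    (hctr : ∀ k, ∀ g ∈ W, ∀ (U : D.carriers.BgB) (Z : D.carriers.Dom) (j : InnerLabel D.carriers.Dom (Bnd D.toTwoRuns))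
      (a' : (Jc Z j ⊕ 𝒵 Z j) → ℝ × ℝ),
      (∀ ii jj, ‖linForm (L.A Z j).base (L.A Z j).rd (ctr k g U).1 a' ii jj‖ ≤ β₀ Z j) ∧
      ((linForm (L.A Z j).base (L.A Z j).rd (ctr k g U).1 a').det).im = 0 ∧ d₀ Z j ≤ ((linForm (L.A Z j).base (L.A Z j).rd (ctr k g U).1 a').det).re ∧
      (∀ x : mI Z j → ℂ, γ Z j * nsq x ≤ (star x ⬝ᵥ (linForm (L.A Z j).base (L.A Z j).rd (ctr k g U).1 a' *ᵥ x)).re))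
    (hbud : ∀ k Z j, detBudget (Fintype.card (mI Z j)) (β₀ Z j) (ϑ Z j) (R' k) < d₀ Z j)
    (hmq : ∀ k Z j, Fintype.card (mI Z j) * ϑ Z j * R' k < γ Z j)
    {k : ℕ} {g : ℕ → ℝ} (hg : g ∈ W) {U : D.carriers.BgB} {op : OpDatum (SpeciesRec D o T ι' Ω 𝒴)} {h₀ w : B13HistM P} {ϱ : ℝ}
    (hO : ‖op - (ctr k g U).1‖ ≤ ROp k) (hH : ‖h₀ - (ctr k g U).2‖ + ϱ * ‖w‖ ≤ RHist k)
    {emb : 𝔇.Dom → D.carriers.Dom} (hscale : ∀ Z, D.carriers.scale (emb Z) = k)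
    (terms : 𝔇.Dom → Finset (D.carriers.Dom × InnerLabel D.carriers.Dom (Bnd D.toTwoRuns)))
    {A₀ A₁ R r₁ b₅ : ℝ} {X₀ : 𝔇.Dom} (hA₀ : 0 ≤ A₀) (hA₁ : 0 ≤ A₁) (hr₁ : 0 ≤ r₁) (hb : r₁ * 5 ≤ b₅)
    (hrate : r₁ + 2 * Ge.κ₀ + 2 ≤ R) (hsmall : (A₀ + ϱ * A₁) * Real.exp (b₅ + 1) * Ge.K₀ * Ge.ν * Ge.c₁ ≤ 1)
    (hM3 : ∀ Z, Ge.cubes Z ⊆ Ge.cubes X₀ →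
      ∑ p ∈ terms Z, (coreOf P (OpDatum (SpeciesRec D o T ι' Ω 𝒴)) 𝒵 dom Jc V
            (coreLettersOf D P (OpDatum (SpeciesRec D o T ι' Ω 𝒴)) 𝒵 dom Jc V mI L.A) p.1 p.2).lam.real univ *
          ((coreOf P (OpDatum (SpeciesRec D o T ι' Ω 𝒴)) 𝒵 dom Jc V
              (coreLettersOf D P (OpDatum (SpeciesRec D o T ι' Ω 𝒴)) 𝒵 dom Jc V mI L.A) p.1 p.2).wB *
              (gaussC (mI p.1 p.2) * Real.sqrt (max 1 ((Fintype.card (mI p.1 p.2)).factorial *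
                β₀ p.1 p.2 ^ Fintype.card (mI p.1 p.2) + d₀ p.1 p.2))) * Real.exp 0) *
          (Real.pi / ((γ p.1 p.2 - Fintype.card (mI p.1 p.2) * ϑ p.1 p.2 * R' k) / 2 / 2)) ^ (Module.finrank ℝ (V p.1 p.2) / 2 : ℝ) *
        Real.exp ((coreOf P (OpDatum (SpeciesRec D o T ι' Ω 𝒴)) 𝒵 dom Jc V
            (coreLettersOf D P (OpDatum (SpeciesRec D o T ι' Ω 𝒴)) 𝒵 dom Jc V mI L.A) p.1 p.2).N₁ * (‖h₀‖ + ϱ * ‖w‖)) ≤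
        (A₀ + ϱ * A₁) * Real.exp (-(R * 𝔇.dj Z)))
    (hϱ : 2 ≤ ϱ) (hϱA : A₀ ≤ ϱ * A₁) :
    ‖locE Ge.ι Ge.cubes (fun Z => ∑ p ∈ terms Z, (slotsOfRecord D ι c a s P 𝒵 dom Jc V mI L).act p.1 p.2 op (h₀ + w)) (Ge.cubes X₀) -
        locE Ge.ι Ge.cubes (fun Z => ∑ p ∈ terms Z, (slotsOfRecord D ι c a s P 𝒵 dom Jc V mI L).act p.1 p.2 op h₀) (Ge.cubes X₀)‖ ≤
      4 * (Real.exp 1 * Ge.ν * Ge.c₁ * Ge.K₀ ^ 2) * A₁ * Real.exp (-(r₁ * 𝔇.dj X₀)) := by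
  rw [slotsOfRecord_act]
  exact attachedPart_locE_le_of_coreLettersOf D P (OpDatum (SpeciesRec D o T ι' Ω 𝒴)) 𝒵 dom Jc V mI 𝔇 Ge L.A hroom hR' hbase hrdm
    hβ₀ hd₀ hrd hctr hbud hmq hg hO hH hscale terms hA₀ hA₁ hr₁ hb hrate hsmall hM3 hϱ hϱA

open Classical in
/-- **THE μ-PART OF THE DRESSED SMALL-FIELD OUTPUT OF THE ACTIVITY SLOT OF RECORD** (kernel; §2's `muPart_locE_le_of_coreLettersOf`
at `Op := OpDatum (SpeciesRec …)`, `A := L.A`, activities LITERALLY `(slotsOfRecord …).act p.1 p.2 op h`; source pencil `h₀ + s • v`). [folklore] -/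
theorem muPart_locE_le_slotsOfRecord_act {W : Set (ℕ → ℝ)}
    {ctr : ℕ → (ℕ → ℝ) → D.carriers.BgB → OpDatum (SpeciesRec D o T ι' Ω 𝒴) × B13HistM P} {ROp RHist R' : ℕ → ℝ}
    {β₀ ϑ d₀ γ : D.carriers.Dom → InnerLabel D.carriers.Dom (Bnd D.toTwoRuns) → ℝ}
    (hroom : ∀ k, ROp k < R' k) (hR' : ∀ k, 0 ≤ R' k)
    (hbase : ∀ Z j ii jj, Measurable fun a' => (L.A Z j).base a' ii jj)
    (hrdm : ∀ Z j ii jj (o' : OpDatum (SpeciesRec D o T ι' Ω 𝒴)), Measurable fun a' => (L.A Z j).rd a' ii jj o')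
    (hβ₀ : ∀ Z j, 0 ≤ β₀ Z j) (hd₀ : ∀ Z j, 0 < d₀ Z j)
    (hrd : ∀ Z j a' ii jj, ‖(L.A Z j).rd a' ii jj‖ ≤ ϑ Z j)
    (hctr : ∀ k, ∀ g ∈ W, ∀ (U : D.carriers.BgB) (Z : D.carriers.Dom) (j : InnerLabel D.carriers.Dom (Bnd D.toTwoRuns))
      (a' : (Jc Z j ⊕ 𝒵 Z j) → ℝ × ℝ),
      (∀ ii jj, ‖linForm (L.A Z j).base (L.A Z j).rd (ctr k g U).1 a' ii jj‖ ≤ β₀ Z j) ∧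
      ((linForm (L.A Z j).base (L.A Z j).rd (ctr k g U).1 a').det).im = 0 ∧ d₀ Z j ≤ ((linForm (L.A Z j).base (L.A Z j).rd (ctr k g U).1 a').det).re ∧
      (∀ x : mI Z j → ℂ, γ Z j * nsq x ≤ (star x ⬝ᵥ (linForm (L.A Z j).base (L.A Z j).rd (ctr k g U).1 a' *ᵥ x)).re))
    (hbud : ∀ k Z j, detBudget (Fintype.card (mI Z j)) (β₀ Z j) (ϑ Z j) (R' k) < d₀ Z j)
    (hmq : ∀ k Z j, Fintype.card (mI Z j) * ϑ Z j * R' k < γ Z j)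
    {k : ℕ} {g : ℕ → ℝ} (hg : g ∈ W) {U : D.carriers.BgB} {op : OpDatum (SpeciesRec D o T ι' Ω 𝒴)} {h₀ v : B13HistM P} {μ₁ : ℝ}
    (hO : ‖op - (ctr k g U).1‖ ≤ ROp k) (hH : ‖h₀ - (ctr k g U).2‖ + μ₁ * ‖v‖ ≤ RHist k)
    {emb : 𝔇.Dom → D.carriers.Dom} (hscale : ∀ Z, D.carriers.scale (emb Z) = k)
    (terms : 𝔇.Dom → Finset (D.carriers.Dom × InnerLabel D.carriers.Dom (Bnd D.toTwoRuns)))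
    {A' R r₁ b₅ μ₀ : ℝ} {X₀ : 𝔇.Dom} {sμ : ℂ} (hA : 0 ≤ A') (hr₁ : 0 ≤ r₁) (hb : r₁ * 5 ≤ b₅)
    (hrate : r₁ + 2 * Ge.κ₀ + 2 ≤ R) (hsmall : A' * Real.exp (b₅ + 1) * Ge.K₀ * Ge.ν * Ge.c₁ ≤ 1)
    (hM3 : ∀ Z, Ge.cubes Z ⊆ Ge.cubes X₀ →
      ∑ p ∈ terms Z, (coreOf P (OpDatum (SpeciesRec D o T ι' Ω 𝒴)) 𝒵 dom Jc V
            (coreLettersOf D P (OpDatum (SpeciesRec D o T ι' Ω 𝒴)) 𝒵 dom Jc V mI L.A) p.1 p.2).lam.real univ *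
          ((coreOf P (OpDatum (SpeciesRec D o T ι' Ω 𝒴)) 𝒵 dom Jc V
              (coreLettersOf D P (OpDatum (SpeciesRec D o T ι' Ω 𝒴)) 𝒵 dom Jc V mI L.A) p.1 p.2).wB *
              (gaussC (mI p.1 p.2) * Real.sqrt (max 1 ((Fintype.card (mI p.1 p.2)).factorial *
                β₀ p.1 p.2 ^ Fintype.card (mI p.1 p.2) + d₀ p.1 p.2))) * Real.exp 0) *
          (Real.pi / ((γ p.1 p.2 - Fintype.card (mI p.1 p.2) * ϑ p.1 p.2 * R' k) / 2 / 2)) ^ (Module.finrank ℝ (V p.1 p.2) / 2 : ℝ) *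
        Real.exp ((coreOf P (OpDatum (SpeciesRec D o T ι' Ω 𝒴)) 𝒵 dom Jc V
            (coreLettersOf D P (OpDatum (SpeciesRec D o T ι' Ω 𝒴)) 𝒵 dom Jc V mI L.A) p.1 p.2).N₁ * (‖h₀‖ + μ₁ * ‖v‖)) ≤
        A' * Real.exp (-(R * 𝔇.dj Z)))
    (h0 : 0 < μ₀) (h01 : μ₀ < μ₁) (hμ : ‖sμ‖ ≤ μ₀) :
    ‖locE Ge.ι Ge.cubes (fun Z => ∑ p ∈ terms Z,
          (slotsOfRecord D ι c a s P 𝒵 dom Jc V mI L).act p.1 p.2 op (h₀ + sμ • v)) (Ge.cubes X₀) -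
        locE Ge.ι Ge.cubes (fun Z => ∑ p ∈ terms Z, (slotsOfRecord D ι c a s P 𝒵 dom Jc V mI L).act p.1 p.2 op h₀) (Ge.cubes X₀)‖ ≤
      Real.exp 1 * Ge.ν * Ge.c₁ * Ge.K₀ ^ 2 * A' * Real.exp (-(r₁ * 𝔇.dj X₀)) * (μ₀ / (μ₁ - μ₀)) := by
  rw [slotsOfRecord_act]
  exact muPart_locE_le_of_coreLettersOf D P (OpDatum (SpeciesRec D o T ι' Ω 𝒴)) 𝒵 dom Jc V mI 𝔇 Ge L.A hroom hR' hbase hrdm hβ₀ hd₀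
    hrd hctr hbud hmq hg hO hH hscale terms hA hr₁ hb hrate hsmall hM3 h0 h01 hμ

end SlotsOfRecord

end Summit.QuantumFields.BalabanUV.T4Continuum.NE1p.DressedSmallFieldOnCoresSlotLetters

end
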